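import Summits.CriticalPhenomena.PercolationContinuityZ3.Theorems.Transplant.SkelPhiNegReachReadBK
import Summits.CriticalPhenomena.PercolationContinuityZ3.Theorems.Transplant.SkelPhiNegReachReadC
import HarnessLib

/-!
# N1 (the `{±1}` node), (C) column under (ζ′) — file (C-S9c-K): ONE-SIDED AND DRIFTING READING BOUNDS WITH THE BOX MULTIPLIER `kq`
# (the twin of `SkelPhiNegReachReadC` (C-S9c, p300583) at `40·kq` strides per `r`, commensurability `c_i'·A·(40kq·Δ) = r_i·D`, `40kq ≤ r_i`):
# **`readLo0/Hi0_of_budgetK`** (`Δ·B + |v_α|·U·(X₁+1) + 3Δ·n ≤ 40kq·m·Δ·n ⟹ −(m·r₀) + 1 ≤ rdLo₀`, `rdHi₀ ≤ m·r₀ − 1`),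
# **`readLo1/Hi1_of_budgetK`** (`U·B + 2Δ ≤ 40kq·m·Δ`, resp. `U·(B+1) + 2Δ ≤ 40kq·m·Δ`), and the across reading of a DRIFTING box
# **`readAcross0_driftK`** (`r₀·(Δ·B + |v_α|·U·(ρ+1) + |v_α|·E) + 40kq·Δ·n + r₀·n ≤ 40kq·Δ·n·Y`); the anchor lemma `mixed_anchor` is the record's.
# The case `kq = 1` is the record (C-S9c).

builds on p205010 (kernel theorem, internal audit signed; external expert review pending) — nothing in this file uses p205010; nothing here is a
claim about the open node `SamePDropOfSkeletonNeg₁`.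
Lane `prim-bschramm`, seat `prim-bschramm-p5` (gen 11; (C) lineage); helper file (`--supports stmt-CriticalPhenomena-4575`).
[cite: KozmaNitzan2024, §4 Lemma 11 (p. 22), Lemma 12 (pp. 23–25)] [cite: MartineauTassion2017, §4.1]
-/

noncomputable section

namespace Summit.CriticalPhenomena.PercolationContinuityZ3.Theorems

namespace Transplant

namespace Skelφ

open Literature.Probability.Percolation Literature.Probability.LatticeModels
open Literature.Probability.Percolation.KozmaNitzan.Cells (oth oth_ne sgOf sgOf_sign eq_oth_of_ne)
open TwoAxis.Para (modulus)
open ChainPlanar ChainPara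

section Budget

variable {A : ℤ} {n : ℕ} {h vα vβ c₀' c₁' D : ℤ} {P : PCells2}
  {kq : ℕ} (hn : 1 ≤ n) (hA : 0 < A) (hD : 0 < D) (hm : 0 < modulus n h vα vβ) (hc₀ : 0 < c₀') (hkq : 1 ≤ kq)
  (hsc0 : c₀' * A * (40 * (kq : ℤ) * modulus n h vα vβ) = (P.r 0 : ℤ) * D) (hsc1 : c₁' * A * (40 * (kq : ℤ) * modulus n h vα vβ) = (P.r 1 : ℤ) * D)
  (hr40 : ∀ i, 40 * (kq : ℤ) ≤ (P.r i : ℤ))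

/-! ## §1 One-sided budgets, axis `0` -/

include hn hA hD hm hc₀ hkq hsc0 hr40 in
/-- **Axis-`0` lower budget**: `lo₀ ≥ −B`, `|lo₁|, |hi₁| ≤ X₁`, `Δ·B + |v_α|·U·(X₁+1) + 3Δ·n ≤ 40·m·Δ·n ⟹ −(m·r₀) + 1 ≤ rdLo₀`. [this work] -/
theorem readLo0_of_budgetK {lo hi : Site 2} {B X₁ m : ℤ} (h0 : -B ≤ lo 0) (h1l : |lo 1| ≤ X₁) (h1h : |hi 1| ≤ X₁)
    (hbud : modulus n h vα vβ * B + |vα| * ((shearUnit n h : ℤ) * (X₁ + 1)) + 3 * modulus n h vα vβ * n ≤ 40 * (kq : ℤ) * m * modulus n h vα vβ * n) :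
    -(m * (P.r 0 : ℤ)) + 1 ≤ rdLo A n h vα vβ c₀' c₁' D lo hi 0 := by
  have hr0 : 40 * (kq : ℤ) ≤ P.r 0 := hr40 0
  have hkq' : (1 : ℤ) ≤ kq := by exact_mod_cast hkq
  have hr0' : (0 : ℤ) ≤ P.r 0 := by linarith
  have hΔ : (0 : ℤ) < modulus n h vα vβ := hm
  have hn1 : (1 : ℤ) ≤ n := by exact_mod_cast hn
  set C := |vα| * ((shearUnit n h : ℤ) * (X₁ + 1)) with hC
  have hmax : max (vα * ((shearUnit n h : ℤ) * lo 1)) (vα * ((shearUnit n h : ℤ) * hi 1 + shearUnit n h - 1)) ≤ C :=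
    max_le ((le_abs_self _).trans (mixed_le hn hm h1l).1) ((le_abs_self _).trans (mixed_le hn hm h1h).2)
  refine rdLo_zero_geK hn hA hD hm hc₀ hkq hsc0 ?_
  have h1 : (P.r 0 : ℤ) * (modulus n h vα vβ * (-B) - C) ≤
      (P.r 0 : ℤ) * (modulus n h vα vβ * lo 0 - max (vα * ((shearUnit n h : ℤ) * lo 1)) (vα * ((shearUnit n h : ℤ) * hi 1 + shearUnit n h - 1))) :=
    mul_le_mul_of_nonneg_left (by have := mul_le_mul_of_nonneg_left h0 hΔ.le; linarith) (by linarith)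
  have h2 : (P.r 0 : ℤ) * (modulus n h vα vβ * B + C + 3 * modulus n h vα vβ * n) ≤ (P.r 0 : ℤ) * (40 * (kq : ℤ) * m * modulus n h vα vβ * n) :=
    mul_le_mul_of_nonneg_left hbud (by linarith)
  have h3 : 40 * (kq : ℤ) * (modulus n h vα vβ * n) ≤ modulus n h vα vβ * n * (P.r 0 : ℤ) := by
    have := mul_le_mul_of_nonneg_left hr0 (show (0:ℤ) ≤ modulus n h vα vβ * n by positivity); linarith
  have h4 : (P.r 0 : ℤ) * n ≤ modulus n h vα vβ * n * (P.r 0 : ℤ) := by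
    have := mul_le_mul_of_nonneg_left (show (1:ℤ) ≤ modulus n h vα vβ from hm) (show (0:ℤ) ≤ n * (P.r 0 : ℤ) by positivity); linarith
  have h5 : (0 : ℤ) ≤ modulus n h vα vβ * n * (P.r 0 : ℤ) := by positivity
  linarith

include hn hD hm hc₀ hkq hsc0 hr40 in
/-- **Axis-`0` upper budget**: `hi₀ ≤ B`, `|lo₁|, |hi₁| ≤ X₁`, `Δ·B + |v_α|·U·(X₁+1) + 3Δ·n ≤ 40·m·Δ·n ⟹ rdHi₀ ≤ m·r₀ − 1`. [this work] -/
theorem readHi0_of_budgetK {lo hi : Site 2} {B X₁ m : ℤ} (h0 : hi 0 ≤ B) (h1l : |lo 1| ≤ X₁) (h1h : |hi 1| ≤ X₁)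
    (hbud : modulus n h vα vβ * B + |vα| * ((shearUnit n h : ℤ) * (X₁ + 1)) + 3 * modulus n h vα vβ * n ≤ 40 * (kq : ℤ) * m * modulus n h vα vβ * n) :
    rdHi A n h vα vβ c₀' c₁' D lo hi 0 ≤ m * (P.r 0 : ℤ) - 1 := by
  have hr0 : 40 * (kq : ℤ) ≤ P.r 0 := hr40 0
  have hkq' : (1 : ℤ) ≤ kq := by exact_mod_cast hkq
  have hr0' : (0 : ℤ) ≤ P.r 0 := by linarith
  have hΔ : (0 : ℤ) < modulus n h vα vβ := hm
  have hn1 : (1 : ℤ) ≤ n := by exact_mod_cast hn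
  set C := |vα| * ((shearUnit n h : ℤ) * (X₁ + 1)) with hC
  have hmin : -C ≤ min (vα * ((shearUnit n h : ℤ) * lo 1)) (vα * ((shearUnit n h : ℤ) * hi 1 + shearUnit n h - 1)) :=
    le_min ((neg_le_neg (mixed_le hn hm h1l).1).trans (neg_abs_le _)) ((neg_le_neg (mixed_le hn hm h1h).2).trans (neg_abs_le _))
  refine rdHi_zero_leK hn hD hm hc₀ hkq hsc0 ?_
  have h1 : (P.r 0 : ℤ) * (modulus n h vα vβ * hi 0 - min (vα * ((shearUnit n h : ℤ) * lo 1)) (vα * ((shearUnit n h : ℤ) * hi 1 + shearUnit n h - 1))) ≤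
      (P.r 0 : ℤ) * (modulus n h vα vβ * B + C) :=
    mul_le_mul_of_nonneg_left (by have := mul_le_mul_of_nonneg_left h0 hΔ.le; linarith) (by linarith)
  have h2 : (P.r 0 : ℤ) * (modulus n h vα vβ * B + C + 3 * modulus n h vα vβ * n) ≤ (P.r 0 : ℤ) * (40 * (kq : ℤ) * m * modulus n h vα vβ * n) :=
    mul_le_mul_of_nonneg_left hbud (by linarith)
  have h3 : 40 * (kq : ℤ) * (modulus n h vα vβ * n) < 3 * (modulus n h vα vβ * n * (P.r 0 : ℤ)) := by
    have := mul_le_mul_of_nonneg_left hr0 (show (0:ℤ) ≤ modulus n h vα vβ * n by positivity)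
    have : 0 < modulus n h vα vβ * n * (P.r 0 : ℤ) := by
      have : (0 : ℤ) < P.r 0 := by linarith
      positivity
    linarith
  have h5 : (0 : ℤ) ≤ modulus n h vα vβ * n * (P.r 0 : ℤ) := by positivity
  linarith

/-! ## §2 One-sided budgets, axis `1` -/

include hD hm hkq hsc1 hr40 in
/-- **Axis-`1` lower budget**: `lo₁ ≥ −B`, `U·B + 2Δ ≤ 40·m·Δ ⟹ −(m·r₁) + 1 ≤ rdLo₁`. [this work] -/
theorem readLo1_of_budgetK {lo hi : Site 2} {B m : ℤ} (h1 : -B ≤ lo 1)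
    (hbud : (shearUnit n h : ℤ) * B + 2 * modulus n h vα vβ ≤ 40 * (kq : ℤ) * m * modulus n h vα vβ) :
    -(m * (P.r 1 : ℤ)) + 1 ≤ rdLo A n h vα vβ c₀' c₁' D lo hi 1 := by
  have hr1 : 40 * (kq : ℤ) ≤ P.r 1 := hr40 1
  have hkq' : (1 : ℤ) ≤ kq := by exact_mod_cast hkq
  have hr1' : (0 : ℤ) ≤ P.r 1 := by linarith
  have hΔ : (0 : ℤ) < modulus n h vα vβ := hm
  have hU : (0 : ℤ) ≤ shearUnit n h := by positivity
  refine rdLo_one_geK hD hm hkq hsc1 ?_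
  have a1 : (P.r 1 : ℤ) * ((shearUnit n h : ℤ) * (-B)) ≤ (P.r 1 : ℤ) * ((shearUnit n h : ℤ) * lo 1) :=
    mul_le_mul_of_nonneg_left (mul_le_mul_of_nonneg_left h1 hU) (by linarith)
  have a2 : (P.r 1 : ℤ) * ((shearUnit n h : ℤ) * B + 2 * modulus n h vα vβ) ≤ (P.r 1 : ℤ) * (40 * (kq : ℤ) * m * modulus n h vα vβ) :=
    mul_le_mul_of_nonneg_left hbud (by linarith)
  have a3 : 40 * (kq : ℤ) * modulus n h vα vβ ≤ modulus n h vα vβ * (P.r 1 : ℤ) := by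
    have := mul_le_mul_of_nonneg_left hr1 hΔ.le; linarith
  have a5 : (0 : ℤ) ≤ modulus n h vα vβ * (P.r 1 : ℤ) := by positivity
  linarith

include hD hm hkq hsc1 hr40 in
/-- **Axis-`1` upper budget**: `hi₁ ≤ B`, `U·(B+1) + 2Δ ≤ 40·m·Δ ⟹ rdHi₁ ≤ m·r₁ − 1`. [this work] -/
theorem readHi1_of_budgetK {lo hi : Site 2} {B m : ℤ} (h1 : hi 1 ≤ B)
    (hbud : (shearUnit n h : ℤ) * (B + 1) + 2 * modulus n h vα vβ ≤ 40 * (kq : ℤ) * m * modulus n h vα vβ) :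
    rdHi A n h vα vβ c₀' c₁' D lo hi 1 ≤ m * (P.r 1 : ℤ) - 1 := by
  have hr1 : 40 * (kq : ℤ) ≤ P.r 1 := hr40 1
  have hkq' : (1 : ℤ) ≤ kq := by exact_mod_cast hkq
  have hr1' : (0 : ℤ) ≤ P.r 1 := by linarith
  have hΔ : (0 : ℤ) < modulus n h vα vβ := hm
  have hU : (0 : ℤ) ≤ shearUnit n h := by positivity
  refine rdHi_one_leK hD hm hkq hsc1 ?_
  have a1 : (P.r 1 : ℤ) * ((shearUnit n h : ℤ) * hi 1 + shearUnit n h - 1) ≤ (P.r 1 : ℤ) * ((shearUnit n h : ℤ) * (B + 1) - 1) :=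
    mul_le_mul_of_nonneg_left (by have := mul_le_mul_of_nonneg_left h1 hU; linarith) (by linarith)
  have a2 : (P.r 1 : ℤ) * ((shearUnit n h : ℤ) * (B + 1) + 2 * modulus n h vα vβ) ≤ (P.r 1 : ℤ) * (40 * (kq : ℤ) * m * modulus n h vα vβ) :=
    mul_le_mul_of_nonneg_left hbud (by linarith)
  have a3 : 40 * (kq : ℤ) * modulus n h vα vβ ≤ modulus n h vα vβ * (P.r 1 : ℤ) := by
    have := mul_le_mul_of_nonneg_left hr1 hΔ.le; linarith
  have a5 : (0 : ℤ) ≤ modulus n h vα vβ * (P.r 1 : ℤ) := by positivity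
  have a4 : (0 : ℤ) < P.r 1 := by linarith
  linarith

/-! ## §3 The across reading of a drifting box -/

include hn hA hD hm hc₀ hkq hsc0 in
/-- **The across reading of a drifting box** (axis `0`): `v_α·t − B ≤ lo₀`, `hi₀ ≤ v_α·t + B`, the along corners within `c ± ρ`, anchor mismatch
`|Δ·t − U·c| ≤ E`; then `−Y + 1 ≤ rdLo₀` and `rdHi₀ ≤ Y − 1` as soon as `r₀·(Δ·B + |v_α|·U·(ρ+1) + |v_α|·E) + 40Δ·n + r₀·n ≤ 40·Δ·n·Y`.
[this work] -/
theorem readAcross0_driftK {lo hi : Site 2} {t B c ρ E Y : ℤ} (hlo : vα * t - B ≤ lo 0) (hhi : hi 0 ≤ vα * t + B)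
    (hl : |lo 1 - c| ≤ ρ) (hh : |hi 1 - c| ≤ ρ) (hE : |modulus n h vα vβ * t - (shearUnit n h : ℤ) * c| ≤ E)
    (hY : (P.r 0 : ℤ) * (modulus n h vα vβ * B + |vα| * ((shearUnit n h : ℤ) * (ρ + 1)) + |vα| * E) + 40 * (kq : ℤ) * modulus n h vα vβ * n + (P.r 0 : ℤ) * n ≤
      40 * (kq : ℤ) * modulus n h vα vβ * (n * Y)) :
    -Y + 1 ≤ rdLo A n h vα vβ c₀' c₁' D lo hi 0 ∧ rdHi A n h vα vβ c₀' c₁' D lo hi 0 ≤ Y - 1 := by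
  have hr0 : (0 : ℤ) ≤ P.r 0 := by positivity
  have hΔ : (0 : ℤ) < modulus n h vα vβ := hm
  obtain ⟨hmax, hmin⟩ := mixed_anchor (vα := vα) hn hm hl hh
  -- the anchor term `v·(Δ t − U c)` is bounded by `|v|·E`
  have hanch : |vα * (modulus n h vα vβ * t - (shearUnit n h : ℤ) * c)| ≤ |vα| * E := by
    rw [abs_mul]; exact mul_le_mul_of_nonneg_left hE (abs_nonneg _)
  have ha := abs_le.1 hanch
  have e : vα * (modulus n h vα vβ * t) - vα * ((shearUnit n h : ℤ) * c) = vα * (modulus n h vα vβ * t - (shearUnit n h : ℤ) * c) := by ring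
  constructor
  · refine rdLo_zero_geK hn hA hD hm hc₀ hkq hsc0 ?_
    have h1 : modulus n h vα vβ * (vα * t - B) ≤ modulus n h vα vβ * lo 0 := mul_le_mul_of_nonneg_left hlo hΔ.le
    have hmt : modulus n h vα vβ * (vα * t) = vα * (modulus n h vα vβ * t) := by ring
    have h2 : (P.r 0 : ℤ) * (-(modulus n h vα vβ * B + |vα| * ((shearUnit n h : ℤ) * (ρ + 1)) + |vα| * E)) ≤
        (P.r 0 : ℤ) * (modulus n h vα vβ * lo 0 - max (vα * ((shearUnit n h : ℤ) * lo 1)) (vα * ((shearUnit n h : ℤ) * hi 1 + shearUnit n h - 1))) :=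
      mul_le_mul_of_nonneg_left (by rw [mul_sub] at h1; linarith [ha.1]) hr0
    have hkq' : (0 : ℤ) < kq := by exact_mod_cast hkq
    have hn0 : (0 : ℤ) < n := by exact_mod_cast hn
    have h3 : (0 : ℤ) < 40 * (kq : ℤ) * modulus n h vα vβ * n := mul_pos (mul_pos (mul_pos (by norm_num) hkq') hΔ) hn0
    linarith
  · refine rdHi_zero_leK hn hD hm hc₀ hkq hsc0 ?_
    have h1 : modulus n h vα vβ * hi 0 ≤ modulus n h vα vβ * (vα * t + B) := mul_le_mul_of_nonneg_left hhi hΔ.le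
    have hmt : modulus n h vα vβ * (vα * t) = vα * (modulus n h vα vβ * t) := by ring
    have h2 : (P.r 0 : ℤ) * (modulus n h vα vβ * hi 0 - min (vα * ((shearUnit n h : ℤ) * lo 1)) (vα * ((shearUnit n h : ℤ) * hi 1 + shearUnit n h - 1))) ≤
        (P.r 0 : ℤ) * (modulus n h vα vβ * B + |vα| * ((shearUnit n h : ℤ) * (ρ + 1)) + |vα| * E) :=
      mul_le_mul_of_nonneg_left (by rw [mul_add] at h1; linarith [ha.2]) hr0
    have hr1 : (1 : ℤ) ≤ P.r 0 := by exact_mod_cast P.one_le_r 0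
    have h4 : (0 : ℤ) < (P.r 0 : ℤ) * n := by
      have hn0 : (0 : ℤ) < n := by exact_mod_cast hn
      nlinarith
    linarith

end Budget

end Skelφ

end Transplant

end Summit.CriticalPhenomena.PercolationContinuityZ3.Theorems

end
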